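import Summits.BirchSwinnertonDyer.BirchSwinnertonDyer.Theorems.GenusKolyvaginAtTwoPowDvdShaCardAtTwoRTTwinShaLaddersOfProp52Record
import HarnessLib

/-!
# Route `GenusKolyvaginAtTwo`, LINE 18 (L_T `PowDvdShaCardAtTwoRT`, stmt-BirchSwinnertonDyer-23242), stub L
# `stub_twinShaLaddersAtTwo` ⟸ (P52rec[G]): Prop. 5.2 at 2 at record depths, over a SUPPLIER-CHOSEN class of deep primes

Seat `bsd-line-gk2-p2` g19 (PROVER seat 2/3, cell `bsd-f1-sign2`), `--supports stmt-BirchSwinnertonDyer-23242` (helper; closes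
nothing). THEOREMS ONLY (no definition, no named fact, no `sorry`); BSD is not proved by any of this.

WHAT. `twinShaLadders_of_prop52RecordAtTwo` (g18, `…RTTwinShaLaddersOfProp52Record`) asks its supplier for McCallum's Prop. 5.2 at
`2` in Kolyvagin's divisibility currency at record depths, with the lower bound `2^{M_r} ∣ P_d(n′)` quantified over EVERY square-free
depth-`r` level `n′` of Zhang–Kolyvagin primes of index `≥ L`, and the witness `(n, d)` taken from the same class.  The engines of the
line (gk2-p4's pair Čebotarev `RelaxedCount.exists_deep_kolyvaginPrime_fullOrder_pair_of_data`, gk2-p5's eigen index law at a deep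
prime, the two-term reciprocity with the lost-bit law) work at primes carrying MORE than the index: Gross's Frobenius condition
`FrobEqFrobInfty W K 2 ℓ` (lifted to `2^L` by gk2-p5's `GrossLevelAtTwo.frobEqFrobInfty_two_pow_of_frobEqFrobInfty_two`, p720492), and a
swap loop that starts from a level attaining the minimum must start INSIDE that class — so the minima, the lower bound and the witnesses
must all live over ONE supplier-chosen class of primes.  This file states the interface with an arbitrary extra prime predicate
`G : ℕ → Prop`, chosen by the supplier together with the level `L`:
* `kolyvaginSuppliesAtTwo_of_prop52Record_pred` — (KS) (the registered stub's conclusion shape, whose witnesses only need index `≥ L`)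
  from (P52rec[G]): `∃ L R k G`, `k R = L`, and for `1 ≤ r ≤ R`: `k r ≤ L`; `2^{L − k r} ∣ P_d(n′)` for every square-free depth-`r`
  `n′` all of whose primes are Zhang–Kolyvagin of index `≥ L` AND satisfy `G`; at record depths, for every `≤ r`-generated
  `⟨u⟩ ⊂ Sel_{2^L}(E/K)^{ε_r}` a depth-`r` `(n, d)` in the same class with `2^{L−k r+1} ∤ P_d(n)` and a non-zero multiple `2^j c_L(n)`
  avoiding `⟨u⟩`.  (`G := fun _ ↦ True` is (P52rec).)  The proof is g18's, with `G` carried along: the annihilation one level down is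
  only ever used at the sub-levels `n/ℓ` of a witness, whose primes inherit `G`.
* `twinShaLadders_of_prop52RecordAtTwo_pred` — stub L's conclusion on its own binders from `0 < M₀ → (P52rec[G])`.

References: [McCallumLMS1991] §5 Prop. 5.2 (statement; proof pp. 308–310, the case `M_{r−1} > M_r`), Lemma 5.1, Thm. 5.4, §4 Lemma 4.6,
Cor. 4.5; [GrossLMS1991] §3 (3.1)–(3.3), §4 (4.1), Prop. 5.3.
-/

set_option autoImplicit false
-- the Theorems namespace of this sub repeats the summit name by design (D-0017 nested layout)
set_option linter.dupNamespace false

noncomputable section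

open scoped Classical

namespace Summit.BirchSwinnertonDyer.BirchSwinnertonDyer.Theorems.GenusExact.PlusDescent

open WeierstrassCurve NumberField IsDedekindDomain Field Literature.NumberTheory.EllipticCurves
  Literature.NumberTheory.GaloisRepresentations Literature.NumberTheory.EllipticCurves.ModularForms AddSubgroup
open Summit.BirchSwinnertonDyer.BirchSwinnertonDyer.Theses.GenusKolyvaginAtTwo (KolyvaginRelationAtTwo)

/-- **(KS) ⟸ (P52rec[G])**: the K-side hypothesis of `twinShaLadders_of_kolyvaginSuppliesAtTwo(')` from McCallum's Prop. 5.2 at `2` in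
Kolyvagin's divisibility currency at RECORD depths, over the class of square-free levels all of whose primes are Zhang–Kolyvagin of
index `≥ L` and satisfy a supplier-chosen predicate `G` (e.g. Gross's `FrobEqFrobInfty W K 2 ℓ`): `M_r := L − k r`; lower bound
`2^{M_r} ∣ P(n′)` over that class; at record depths a witness in that class with `2^{M_r} ∥ P(n)` and avoidance by a non-zero multiple;
bottom rung `k R = L`.  Ladder = running minimum; orders by the single-datum order formula; annihilation one level down by the
single-datum Cor. 4.5 at the sub-levels of the witness (which inherit `G`); full avoidance by the socle.
[cite: McCallumLMS1991, §5 Lemma 5.1, Prop. 5.2, p. 309; §4 Cor. 4.5] [cite: GrossLMS1991, §4 (4.1), Prop. 5.3] -/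
theorem kolyvaginSuppliesAtTwo_of_prop52Record_pred (W : WeierstrassCurve ℚ) [W.IsElliptic] [W.IsGloballyMinimal]
    [NeZero (W.conductorNorm ℤ)]
    (K : Type) [Field K] [NumberField K] (hIQ : IsImaginaryQuadratic K) (hodd : Odd (NumberField.discr K))
    (h3 : NumberField.discr K ≠ -3) (hHe : SatisfiesHeegnerHypothesis (W.conductorNorm ℤ) K)
    (hsurj1 : W.HasSurjectiveModNGaloisRep ((2 : ℤ) ^ 1))
    (Dt : ModularParametrizationData W (W.conductorNorm ℤ)) (β : ℤ) (ι : K →+* ℂ) (d₁ : KolyvaginHeegnerData Dt β ι 1) (M₀ : ℕ)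
    (hM₀ : ∃ Q : (W.baseChange (ringClassField K ι 1)).toAffine.Point, ((2 ^ M₀ : ℕ) : ℤ) • Q = d₁.derivedPoint)
    (hKS : ∀ τ : K ≃ₐ[ℚ] K, τ ≠ 1 → ∃ (L R : ℕ) (k : ℕ → ℕ) (G : ℕ → Prop), M₀ + 1 ≤ L ∧ 1 ≤ R ∧ k R = L ∧
      ∀ r : ℕ, 1 ≤ r → r ≤ R →
        k r ≤ L ∧
        (∀ (n : ℕ) (d : KolyvaginHeegnerData Dt β ι n), Squarefree n →
          (∀ ℓ ∈ n.primeFactors, (Zhang2014.IsKolyvaginPrime (W.conductorNorm ℤ) W K 2 ℓ ∧ L ≤ Zhang2014.kolyvaginIndex W 2 ℓ) ∧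
            G ℓ) →
          n.primeFactors.card = r →
          ∃ B : (W.baseChange (ringClassField K ι n)).toAffine.Point, ((2 ^ (L - k r) : ℕ) : ℤ) • B = d.derivedPoint) ∧
        (L - M₀ < k r → (∀ s, 1 ≤ s → s < r → k s < k r) →
          ∀ (i : ℕ) (u : Fin i → galH1Torsion (W.baseChange K) ((2 ^ L : ℕ) : ℤ)), i ≤ r →
          (∀ j, u j ∈ selmerGroup (W.baseChange K) ((2 ^ L : ℕ) : ℤ) ∧
            conjAct W τ ((2 ^ L : ℕ) : ℤ) (u j) = (-W.rootNumber * (-1) ^ r) • u j) →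
          ∃ (n : ℕ) (_ : Squarefree n)
            (_ : ∀ ℓ ∈ n.primeFactors, (Zhang2014.IsKolyvaginPrime (W.conductorNorm ℤ) W K 2 ℓ ∧
              L ≤ Zhang2014.kolyvaginIndex W 2 ℓ) ∧ G ℓ)
            (_ : n.primeFactors.card = r) (d : KolyvaginHeegnerData Dt β ι n),
            (¬ ∃ B : (W.baseChange (ringClassField K ι n)).toAffine.Point, ((2 ^ (L - k r + 1) : ℕ) : ℤ) • B = d.derivedPoint) ∧
            ∃ j : ℕ, ((2 ^ j : ℕ) : ℤ) • d.kolyvaginClass Nat.prime_two L ≠ 0 ∧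
              Disjoint (zmultiples (((2 ^ j : ℕ) : ℤ) • d.kolyvaginClass Nat.prime_two L)) (AddSubgroup.closure (Set.range u)))) :
    ∀ τ : K ≃ₐ[ℚ] K, τ ≠ 1 → ∃ (L R : ℕ) (Mr : ℕ → ℕ), M₀ + 1 ≤ L ∧ (∀ j, Mr (j + 1) ≤ Mr j) ∧ Mr 0 = M₀ ∧ Mr R = 0 ∧
      (∀ m : ℕ, Mr (2 * m + 1) < Mr (2 * m) →
        ∀ (i : ℕ) (u : Fin i → galH1Torsion (W.baseChange K) ((2 ^ L : ℕ) : ℤ)), i ≤ 2 * m + 1 →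
        (∀ j, u j ∈ selmerGroup (W.baseChange K) ((2 ^ L : ℕ) : ℤ) ∧
          conjAct W τ ((2 ^ L : ℕ) : ℤ) (u j) = W.rootNumber • u j) →
        ∃ (n : ℕ) (_ : Squarefree n)
          (_ : ∀ ℓ ∈ n.primeFactors, Zhang2014.IsKolyvaginPrime (W.conductorNorm ℤ) W K 2 ℓ ∧ L ≤ Zhang2014.kolyvaginIndex W 2 ℓ)
          (d : KolyvaginHeegnerData Dt β ι n),
          (∀ ℓ ∈ n.primeFactors, ∀ e : KolyvaginHeegnerData Dt β ι (n / ℓ),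
            ((2 ^ (L - Mr (2 * m)) : ℕ) : ℤ) • e.kolyvaginClass Nat.prime_two L = 0) ∧
          addOrderOf (d.kolyvaginClass Nat.prime_two L) = 2 ^ (L - Mr (2 * m + 1)) ∧
          -W.rootNumber * (-1) ^ n.primeFactors.card = W.rootNumber ∧
          Disjoint (zmultiples (((2 ^ (L - Mr (2 * m)) : ℕ) : ℤ) • d.kolyvaginClass Nat.prime_two L))
            (AddSubgroup.closure (Set.range u))) ∧
      (∀ m : ℕ, Mr (2 * m + 2) < Mr (2 * m + 1) →
        ∀ (i : ℕ) (u : Fin i → galH1Torsion (W.baseChange K) ((2 ^ L : ℕ) : ℤ)), i ≤ 2 * m + 1 →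
        (∀ j, u j ∈ selmerGroup (W.baseChange K) ((2 ^ L : ℕ) : ℤ) ∧
          conjAct W τ ((2 ^ L : ℕ) : ℤ) (u j) = (-W.rootNumber) • u j) →
        ∃ (n : ℕ) (_ : Squarefree n)
          (_ : ∀ ℓ ∈ n.primeFactors, Zhang2014.IsKolyvaginPrime (W.conductorNorm ℤ) W K 2 ℓ ∧ L ≤ Zhang2014.kolyvaginIndex W 2 ℓ)
          (d : KolyvaginHeegnerData Dt β ι n),
          (∀ ℓ ∈ n.primeFactors, ∀ e : KolyvaginHeegnerData Dt β ι (n / ℓ),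
            ((2 ^ (L - Mr (2 * m + 1)) : ℕ) : ℤ) • e.kolyvaginClass Nat.prime_two L = 0) ∧
          addOrderOf (d.kolyvaginClass Nat.prime_two L) = 2 ^ (L - Mr (2 * m + 2)) ∧
          -W.rootNumber * (-1) ^ n.primeFactors.card = -W.rootNumber ∧
          Disjoint (zmultiples (((2 ^ (L - Mr (2 * m + 1)) : ℕ) : ℤ) • d.kolyvaginClass Nat.prime_two L))
            (AddSubgroup.closure (Set.range u) ⊔ zmultiples (d₁.kolyvaginClass Nat.prime_two L))) := by
  -- (g18's proof of `kolyvaginSuppliesAtTwo_of_prop52Record`, with the predicate `G` carried along)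
  intro τ hτ
  obtain ⟨L, R, k, G, hML, hR1, hkR, hdepth⟩ := hKS τ hτ
  have hM₀L : M₀ ≤ L := by omega
  have hL1 : 1 ≤ L := by omega
  have hn0 : ((2 ^ L : ℕ) : ℤ) ≠ 0 := by positivity
  have hne4 : NumberField.discr K ≠ -4 := by
    intro h
    have h' := Int.odd_iff.mp hodd
    rw [h] at h'
    omega
  -- the running-minimum ladder
  obtain ⟨Mr, hMr0, hMrS⟩ : ∃ Mr : ℕ → ℕ, Mr 0 = M₀ ∧ ∀ s, Mr (s + 1) = min (Mr s) (L - k (s + 1)) :=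
    ⟨fun r ↦ Nat.rec (motive := fun _ ↦ ℕ) M₀ (fun s ih ↦ min ih (L - k (s + 1))) r, rfl, fun _ ↦ rfl⟩
  have hstep : ∀ j, Mr (j + 1) ≤ Mr j := fun j ↦ by
    rw [hMrS]
    exact min_le_left _ _
  have hanti : ∀ a b, a ≤ b → Mr b ≤ Mr a := fun a b hab ↦ by
    induction hab with
    | refl => exact le_rfl
    | step _ ih => exact (hstep _).trans ih
  have hMrle : ∀ s, 1 ≤ s → Mr s ≤ L - k s := fun s hs ↦ by
    obtain ⟨t, rfl⟩ : ∃ t, s = t + 1 := ⟨s - 1, by omega⟩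
    rw [hMrS]
    exact min_le_right _ _
  have hMrM₀ : ∀ s, Mr s ≤ M₀ := fun s ↦ hMr0 ▸ hanti 0 s (Nat.zero_le s)
  have hMrR : Mr R = 0 := by
    have h := hMrle R hR1
    rw [hkR, Nat.sub_self] at h
    exact Nat.le_zero.mp h
  -- a drop at depth `s + 1` pins `Mr (s+1) = L - k (s+1)`, forces `s + 1 ≤ R`, and `s + 1` is a RECORD depth
  have hdrop : ∀ s, Mr (s + 1) < Mr s → Mr (s + 1) = L - k (s + 1) ∧ s + 1 ≤ R ∧ L - M₀ < k (s + 1) ∧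
      ∀ t, 1 ≤ t → t < s + 1 → k t < k (s + 1) := fun s hs ↦ by
    have heq : Mr (s + 1) = L - k (s + 1) := by
      rw [hMrS] at hs ⊢
      rcases le_total (Mr s) (L - k (s + 1)) with h | h
      · rw [min_eq_left h] at hs
        exact absurd hs (lt_irrefl _)
      · exact min_eq_right h
    refine ⟨heq, ?_, ?_, fun t ht hts ↦ ?_⟩
    · by_contra hlt
      have h := hanti R s (by omega)
      rw [hMrR] at h
      omega
    · have h := hMrM₀ s
      omega
    · have h1 := hanti t s (by omega)
      have h2 := hMrle t ht
      omega
  -- `H¹(K, E[2^L])` is `2^L`-torsion (for the socle argument)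
  have hV : ∀ v : galH1Torsion (W.baseChange K) ((2 ^ L : ℕ) : ℤ), 2 ^ L • v = 0 := fun v ↦
    AuxiliaryClass.nsmul_galH1Torsion_eq_zero (W := W.baseChange K) (2 ^ L) v
  -- depth `0`: every conductor-`1` datum's class is killed by `2^(L - M₀)` (`2^{M₀} ∣ P(1) = y_K`, the same for all data)
  have hkill0 : ∀ m : ℕ, m = 1 → ∀ e : KolyvaginHeegnerData Dt β ι m,
      ((2 ^ (L - M₀) : ℕ) : ℤ) • e.kolyvaginClass Nat.prime_two L = 0 := by
    rintro m rfl e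
    obtain ⟨Q, hQ⟩ := hM₀
    exact pow_zsmul_kolyvaginClass_two_eq_zero_of_dvd hIQ hodd h3 hHe hsurj1 squarefree_one (by simp [Nat.primeFactors_one]) e
      (Nat.sub_le L M₀) ⟨Q, by
        rw [Nat.sub_sub_self hM₀L]
        exact hQ.trans (AdditiveKoly.derivedPoint_one_eq_derivedPoint_one W K Dt β ι d₁ e)⟩
  -- depth `r ≥ 1`: `2^{M_r} ∣ P(n′)` kills every class at a depth-`r` level of the class (deep ∧ `G`) by `2^(L - Mr r)`
  have hkillr : ∀ r, 1 ≤ r → r ≤ R → ∀ (n : ℕ) (e : KolyvaginHeegnerData Dt β ι n), Squarefree n →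
      (∀ ℓ ∈ n.primeFactors, (Zhang2014.IsKolyvaginPrime (W.conductorNorm ℤ) W K 2 ℓ ∧ L ≤ Zhang2014.kolyvaginIndex W 2 ℓ) ∧
        G ℓ) →
      n.primeFactors.card = r → ((2 ^ (L - Mr r) : ℕ) : ℤ) • e.kolyvaginClass Nat.prime_two L = 0 := by
    intro r hr1 hrR n e hn hdeepG hcard
    obtain ⟨hkL, hbound, -⟩ := hdepth r hr1 hrR
    have hle := hMrle r hr1
    have hkey : ((2 ^ k r : ℕ) : ℤ) • e.kolyvaginClass Nat.prime_two L = 0 :=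
      pow_zsmul_kolyvaginClass_two_eq_zero_of_dvd hIQ hodd h3 hHe hsurj1 hn (fun ℓ hℓ ↦ (hdeepG ℓ hℓ).1) e hkL
        (hbound n e hn hdeepG hcard)
    have hsplit : ((2 ^ (L - Mr r) : ℕ) : ℤ) = ((2 ^ (L - Mr r - k r) : ℕ) : ℤ) * ((2 ^ k r : ℕ) : ℤ) := by
      rw [← Nat.cast_mul, ← pow_add, Nat.sub_add_cancel (by omega)]
    rw [hsplit, mul_smul, hkey]
    exact zsmul_zero _
  -- the annihilation one level down, at a level of the class (deep ∧ `G`) of depth `p + 1`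
  have hkill : ∀ p : ℕ, p + 1 ≤ R → ∀ (n : ℕ), Squarefree n →
      (∀ ℓ ∈ n.primeFactors, (Zhang2014.IsKolyvaginPrime (W.conductorNorm ℤ) W K 2 ℓ ∧ L ≤ Zhang2014.kolyvaginIndex W 2 ℓ) ∧
        G ℓ) →
      n.primeFactors.card = p + 1 → ∀ ℓ ∈ n.primeFactors, ∀ e : KolyvaginHeegnerData Dt β ι (n / ℓ),
        ((2 ^ (L - Mr p) : ℕ) : ℤ) • e.kolyvaginClass Nat.prime_two L = 0 := by
    intro p hpR n hn hdeepG hcard ℓ hℓ e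
    obtain ⟨hsq', hsub, hcard'⟩ := squarefree_div_primeFactors' hn hℓ
    rcases Nat.eq_zero_or_pos p with rfl | hp
    · -- `n = ℓ` is prime: `n / ℓ = 1`
      have h0 : (n / ℓ).primeFactors = ∅ := Finset.card_eq_zero.mp (by omega)
      have h1 : n / ℓ = 1 := by
        rcases Nat.primeFactors_eq_empty.mp h0 with h | h
        · rw [h] at hsq'
          exact absurd hsq' not_squarefree_zero
        · exact h
      rw [hMr0]
      exact hkill0 (n / ℓ) h1 e
    · exact hkillr p hp (by omega) (n / ℓ) e hsq' (fun q hq ↦ hdeepG q (hsub hq)) (by omega)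
  -- the exact order of a witness from `2^{M_r} ∥ P(n)`
  have horder : ∀ r, 1 ≤ r → r ≤ R → ∀ (n : ℕ) (d : KolyvaginHeegnerData Dt β ι n), Squarefree n →
      (∀ ℓ ∈ n.primeFactors, (Zhang2014.IsKolyvaginPrime (W.conductorNorm ℤ) W K 2 ℓ ∧ L ≤ Zhang2014.kolyvaginIndex W 2 ℓ) ∧
        G ℓ) →
      n.primeFactors.card = r →
      (¬ ∃ B : (W.baseChange (ringClassField K ι n)).toAffine.Point, ((2 ^ (L - k r + 1) : ℕ) : ℤ) • B = d.derivedPoint) →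
      addOrderOf (d.kolyvaginClass Nat.prime_two L) = 2 ^ k r := by
    intro r hr1 hrR n d hn hdeepG hcard hk1
    obtain ⟨hkL, hbound, -⟩ := hdepth r hr1 hrR
    rw [← Nat.sub_sub_self hkL]
    exact addOrderOf_kolyvaginClass_two_eq_pow_sub_single hIQ hodd h3 hHe hsurj1 hn (fun ℓ hℓ ↦ (hdeepG ℓ hℓ).1) d
      (Nat.sub_le L (k r)) (hbound n d hn hdeepG hcard) hk1
  refine ⟨L, R, Mr, hML, hstep, hMr0, hMrR, fun m hm i u hi hu ↦ ?_, fun m hm i u hi hu ↦ ?_⟩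
  · -- odd depth `2m + 1`, sign `w(E)`
    obtain ⟨hMreq, hrR, hrec0, hrec⟩ := hdrop (2 * m) hm
    obtain ⟨hkL, -, hsupply⟩ := hdepth (2 * m + 1) (by omega) hrR
    have hsign : -W.rootNumber * (-1) ^ (2 * m + 1) = W.rootNumber := by
      rw [Odd.neg_one_pow ⟨m, rfl⟩]
      ring
    obtain ⟨n, hn, hdeepG, hcard, d, hk1, j, hne, hdisj⟩ := hsupply hrec0 hrec i u hi (fun j ↦ by rw [hsign]; exact hu j)
    have hfull := disjoint_zmultiples_of_disjoint_zmultiples_pow_smul Nat.prime_two hV _ hne hdisj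
    refine ⟨n, hn, fun ℓ hℓ ↦ (hdeepG ℓ hℓ).1, d, hkill (2 * m) hrR n hn hdeepG hcard, ?_, ?_, ?_⟩
    · rw [horder (2 * m + 1) (by omega) hrR n d hn hdeepG hcard hk1, hMreq, Nat.sub_sub_self hkL]
    · rw [hcard]
      exact hsign
    · exact hfull.mono_left (zmultiples_le_of_mem (zsmul_mem_zmultiples _ _))
  · -- even depth `2m + 2`, sign `-w(E)`, McCallum's `C` generated by `u` AND the seed `c_L(1)`
    obtain ⟨hMreq, hrR, hrec0, hrec⟩ := hdrop (2 * m + 1) hm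
    obtain ⟨hkL, -, hsupply⟩ := hdepth (2 * m + 2) (by omega) hrR
    have hsign : -W.rootNumber * (-1) ^ (2 * m + 2) = -W.rootNumber := by
      rw [Even.neg_one_pow ⟨m + 1, by ring⟩]
      ring
    have hdiv : ∀ P : geomPoints (W.baseChange K), ∃ Q : geomPoints (W.baseChange K), ((2 ^ L : ℕ) : ℤ) • Q = P :=
      (W.baseChange K).zsmul_geomPoints_surjective_of_charZero hn0
    obtain ⟨P₀, hP₀⟩ := McCallum1991.exists_map_eq_derivedPoint_one' hIQ d₁
    obtain ⟨hsel1, hc1, hsgn1⟩ := kummerMapTorsion_bottom_mem_selmerGroup_and_conjAct (W := W) (Dt := Dt) (β := β) (ι := ι)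
      hIQ h3 hne4 hodd hHe hsurj1 τ hτ hL1 hdiv d₁ P₀ hP₀
    rw [← hc1] at hsel1 hsgn1
    obtain ⟨n, hn, hdeepG, hcard, d, hk1, j, hne, hdisj⟩ := hsupply hrec0 hrec (i + 1)
      (Fin.cons (d₁.kolyvaginClass Nat.prime_two L) u)
      (by omega) (fun j ↦ by
        rw [hsign]
        refine Fin.cases ?_ (fun j ↦ ?_) j
        · rw [Fin.cons_zero]
          exact ⟨hsel1, hsgn1⟩
        · rw [Fin.cons_succ]
          exact hu j)
    have hfull := disjoint_zmultiples_of_disjoint_zmultiples_pow_smul Nat.prime_two hV _ hne hdisj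
    refine ⟨n, hn, fun ℓ hℓ ↦ (hdeepG ℓ hℓ).1, d, hkill (2 * m + 1) hrR n hn hdeepG hcard, ?_, ?_, ?_⟩
    · rw [horder (2 * m + 2) (by omega) hrR n d hn hdeepG hcard hk1, hMreq, Nat.sub_sub_self hkL]
    · rw [hcard]
      exact hsign
    · refine (hfull.mono_left (zmultiples_le_of_mem (zsmul_mem_zmultiples _ _))).mono_right (sup_le ?_ ?_)
      · exact closure_mono (by
          rintro x ⟨j, rfl⟩
          exact ⟨j.succ, Fin.cons_succ _ _ _⟩)
      · exact zmultiples_le_of_mem (subset_closure ⟨0, Fin.cons_zero _ _⟩)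

/-- **STUB L's CONCLUSION ON ITS OWN FRAME FROM (P52rec[G])** — McCallum's Prop. 5.2 at `2` in Kolyvagin's divisibility currency at
record depths, over the supplier's class of deep levels (Zhang–Kolyvagin of index `≥ L` AND a supplier-chosen prime predicate `G`),
asked only when `M₀ ≥ 1`; composition of `kolyvaginSuppliesAtTwo_of_prop52Record_pred` and `twinShaLadders_of_kolyvaginSuppliesAtTwo'`
(at `M₀ = 0`: `T = 0`).  `G := fun _ ↦ True` recovers `twinShaLadders_of_prop52RecordAtTwo`; the intended `G` is Gross's
`FrobEqFrobInfty W K 2 ℓ`. [cite: McCallumLMS1991, §5 Prop. 5.2, Thm. 5.4] [cite: GrossLMS1991, Thm. 1.3, §3 (3.1)–(3.3), §4 (4.1), Prop. 5.3] -/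
theorem twinShaLadders_of_prop52RecordAtTwo_pred (hP : PubInputsAtTwo) (hQ2 : KolyvaginRelationAtTwo)
    (W : WeierstrassCurve ℚ) [W.IsElliptic] [W.IsGloballyMinimal] [NeZero (W.conductorNorm ℤ)] (hcm : ¬ W.HasCM)
    (hT : Odd W.tamagawaProduct) (K : Type) [Field K] [NumberField K] (hIQ : IsImaginaryQuadratic K)
    (hodd : Odd (NumberField.discr K)) (h3 : NumberField.discr K ≠ -3) (hHe : SatisfiesHeegnerHypothesis (W.conductorNorm ℤ) K)
    (hρ : ∀ n : ℕ, 0 < n → W.HasSurjectiveModNGaloisRep ((2 : ℤ) ^ n))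
    (Dt : ModularParametrizationData W (W.conductorNorm ℤ)) (β : ℤ) (ι : K →+* ℂ) (d₁ : KolyvaginHeegnerData Dt β ι 1)
    (hy : ¬ IsOfFinAddOrder d₁.derivedPoint) (M₀ : ℕ)
    (hM₀ : ∃ Q : (W.baseChange (ringClassField K ι 1)).toAffine.Point, ((2 ^ M₀ : ℕ) : ℤ) • Q = d₁.derivedPoint)
    (hndiv : ¬ ∃ Q : (W.baseChange (ringClassField K ι 1)).toAffine.Point, ((2 ^ (M₀ + 1) : ℕ) : ℤ) • Q = d₁.derivedPoint)
    (Wd : WeierstrassCurve ℚ) [Wd.IsElliptic] (hTw : ∃ C : VariableChange ℚ, C • W.quadraticTwist (NumberField.discr K : ℚ) = Wd)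
    (hKS : 0 < M₀ → ∀ τ : K ≃ₐ[ℚ] K, τ ≠ 1 → ∃ (L R : ℕ) (k : ℕ → ℕ) (G : ℕ → Prop), M₀ + 1 ≤ L ∧ 1 ≤ R ∧ k R = L ∧
      ∀ r : ℕ, 1 ≤ r → r ≤ R →
        k r ≤ L ∧
        (∀ (n : ℕ) (d : KolyvaginHeegnerData Dt β ι n), Squarefree n →
          (∀ ℓ ∈ n.primeFactors, (Zhang2014.IsKolyvaginPrime (W.conductorNorm ℤ) W K 2 ℓ ∧ L ≤ Zhang2014.kolyvaginIndex W 2 ℓ) ∧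
            G ℓ) →
          n.primeFactors.card = r →
          ∃ B : (W.baseChange (ringClassField K ι n)).toAffine.Point, ((2 ^ (L - k r) : ℕ) : ℤ) • B = d.derivedPoint) ∧
        (L - M₀ < k r → (∀ s, 1 ≤ s → s < r → k s < k r) →
          ∀ (i : ℕ) (u : Fin i → galH1Torsion (W.baseChange K) ((2 ^ L : ℕ) : ℤ)), i ≤ r →
          (∀ j, u j ∈ selmerGroup (W.baseChange K) ((2 ^ L : ℕ) : ℤ) ∧
            conjAct W τ ((2 ^ L : ℕ) : ℤ) (u j) = (-W.rootNumber * (-1) ^ r) • u j) →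
          ∃ (n : ℕ) (_ : Squarefree n)
            (_ : ∀ ℓ ∈ n.primeFactors, (Zhang2014.IsKolyvaginPrime (W.conductorNorm ℤ) W K 2 ℓ ∧
              L ≤ Zhang2014.kolyvaginIndex W 2 ℓ) ∧ G ℓ)
            (_ : n.primeFactors.card = r) (d : KolyvaginHeegnerData Dt β ι n),
            (¬ ∃ B : (W.baseChange (ringClassField K ι n)).toAffine.Point, ((2 ^ (L - k r + 1) : ℕ) : ℤ) • B = d.derivedPoint) ∧
            ∃ j : ℕ, ((2 ^ j : ℕ) : ℤ) • d.kolyvaginClass Nat.prime_two L ≠ 0 ∧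
              Disjoint (zmultiples (((2 ^ j : ℕ) : ℤ) • d.kolyvaginClass Nat.prime_two L)) (AddSubgroup.closure (Set.range u)))) :
    ∃ (T : ℕ) (M : ℕ → ℕ), (∀ j, M (j + 1) ≤ M j) ∧ M 0 = M₀ ∧ M (2 * T) = 0 ∧
      (∀ m < T, ∃ x : Fin (2 * m + 2) → W.galH1, (∀ i, resBaseChange W K (x i) ∈ (W.baseChange K).sha) ∧
        (∀ i, addOrderOf (x i) = 2 ^ (M (2 * m) - M (2 * m + 1))) ∧
        ∀ c : Fin (2 * m + 2) → ℤ, ∑ i, c i • x i = 0 → ∀ i, ((2 ^ (M (2 * m) - M (2 * m + 1)) : ℕ) : ℤ) ∣ c i) ∧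
      (∀ m < T, ∃ x : Fin (2 * m + 2) → Wd.galH1, (∀ i, resBaseChange Wd K (x i) ∈ (Wd.baseChange K).sha) ∧
        (∀ i, addOrderOf (x i) = 2 ^ (M (2 * m + 1) - M (2 * m + 2))) ∧
        ∀ c : Fin (2 * m + 2) → ℤ, ∑ i, c i • x i = 0 → ∀ i, ((2 ^ (M (2 * m + 1) - M (2 * m + 2)) : ℕ) : ℤ) ∣ c i) := by
  rcases Nat.eq_zero_or_pos M₀ with rfl | hpos
  · exact ⟨0, fun _ ↦ 0, fun _ ↦ le_rfl, rfl, rfl, fun m hm ↦ absurd hm (Nat.not_lt_zero m),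
      fun m hm ↦ absurd hm (Nat.not_lt_zero m)⟩
  · exact twinShaLadders_of_kolyvaginSuppliesAtTwo' hP hQ2 W hcm hT K hIQ hodd h3 hHe hρ Dt β ι d₁ hy M₀ hndiv Wd hTw
      (kolyvaginSuppliesAtTwo_of_prop52Record_pred W K hIQ hodd h3 hHe (hρ 1 one_pos) Dt β ι d₁ M₀ hM₀ (hKS hpos))

end Summit.BirchSwinnertonDyer.BirchSwinnertonDyer.Theorems.GenusExact.PlusDescent

end
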